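import Mathlib.Topology.Bases
import HarnessLib

/-!
# Galois-countable topological groups ([IUTchI] Remark 2.5.3 (i) (T1))

Mochizuki, *Inter-universal Teichmüller theory I*, Remark 2.5.3 (i) (T1), kurims manuscript p. 52
(the author's erratum to [SemiAnbd] §3) [cite: Mochizuki2012, IUTchI Rmk 2.5.3 (i) (T1), p. 52]:
"We shall say that a tempered group is *Galois-countable* if its topology admits a countable basis."
This is Mathlib's `SecondCountableTopology`; the cell's files state the (E7) hypotheses of
loc. cit. ("in [SemiAnbd] 3.2–3.9 one must assume that all tempered groups, temperoids, and
semi-graphs of anabelioids that appear are Galois-countable") directly as `SecondCountableTopology`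
instance arguments, and this file only records the NAME as a definitional predicate with the two
conversions, for citation by the [IUTchI] §0 files. (Galois-countable semi-graphs of anabelioids,
(T2), are `ProfiniteSemiGraph.IsGaloisCountable` in `TemperedCoverings.lean`.) Nothing is asserted.
-/

namespace Literature.AnabelianGeometry.SemiGraphs

universe u

/-- **[IUTchI] Rmk. 2.5.3 (i) (T1)** (p. 52): a topological group is *Galois-countable* if "its
topology admits a countable basis" — Mathlib `SecondCountableTopology`.
[cite: Mochizuki2012, IUTchI Rmk 2.5.3 (i) (T1), p. 52] -/
@[mk_iff] structure IsGaloisCountable (G : Type u) [TopologicalSpace G] : Prop where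
  /-- the topology admits a countable basis -/
  secondCountableTopology : SecondCountableTopology G

/-- A second countable topological group is Galois-countable.
[cite: Mochizuki2012, IUTchI Rmk 2.5.3 (i) (T1), p. 52] -/
theorem IsGaloisCountable.of_secondCountableTopology (G : Type u) [TopologicalSpace G]
    [SecondCountableTopology G] : IsGaloisCountable G :=
  ⟨inferInstance⟩

/-- A Galois-countable group is second countable (use as `haveI := h.secondCountable`).
[cite: Mochizuki2012, IUTchI Rmk 2.5.3 (i) (T1), p. 52] -/
theorem IsGaloisCountable.secondCountable {G : Type u} [TopologicalSpace G]
    (h : IsGaloisCountable G) : SecondCountableTopology G :=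
  h.secondCountableTopology

end Literature.AnabelianGeometry.SemiGraphs
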